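import Literature.NumberTheory.GaloisCohomology.Howard2004.DVRSettingPiRefinement
import Literature.NumberTheory.GaloisCohomology.Howard2004.DVRSettingPiRefinementRings
import Literature.NumberTheory.GaloisCohomology.Howard2004.DVRSettingPiRefinementResidual
import Literature.NumberTheory.GaloisCohomology.Howard2004.PropagateTowerProofs
import HarnessLib

/-!
# Howard 2004, Remark 1.3.1 on the `π`-adic refinement: the reduced H.4 data are COMPATIBLE along the levels
# (`e_red♯`) and satisfy H.5(c) (`h5c♯`) — for ANY datum with the defining identity (theorems only)

Topic `NumberTheory/GaloisCohomology/Howard2004` (bricks «e_red♯» and «R4c» of the refinement constructor «REFINE» of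
seat `bsd-line-x10b-p1-w2` g16; over R1 `DVRSettingPiRefinement`, R2 `DVRSettingPiRefinementRings`, R2b
`DVRSettingPiRefinementResidual` and «R4a» `PiAdicRefinementDualityDatumProofs` (the reduced datum exists); cell
`pub/bsd-print-x9`, seat `bsd-line-x10b-p1-w8` g10).  THEOREMS ONLY: no definition, no named fact, no instance, no
notation, no `sorry`.  As w2 g16 asked (05:25Z), every statement is about an ARBITRARY datum `Dj` on
`T^{(k)}/π^jT^{(k)}` over `R/π^j` with the defining identity `Dj.e [s] [t] = toQuotRing (e_k(s, t))`, so that the refined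
setting's field `D♯ i := Classical.choose …` instantiates them by `Classical.choose_spec`.

WHY (INPUTS row G87 = `Howard2004.thm161_dvrKolyvaginBound` = Howard Thm. 1.6.1; stub `stub_h161` of the μ-crux
stmt-BirchSwinnertonDyer-22642).  The refined `DVRSetting` must carry the fields `e_red` («the pairings compatible under
reduction», tree `SatisfiesH.e_red`) and `h5c` (Howard's H.5(c): «the residual pairing satisfies `(s^τ, t^τ) = (s,t)^τ`»,
arXiv:1202.6340 p. 7 L98 – p. 8 L1) at every exponent; both follow from the same fields of the original setting
(Remark 1.3.1, p. 7 L125–127).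

* §1 `toQuotRing_e_redLE` — `toQuotRing_j (e_{k'}(x, y)) = toQuotRing_j (e_k(red x, red y))` for `k ≤ k'`, `j ≤ e_k`
  (`SatisfiesH.e_red` iterated along `redLE`, `toQuotRing_redR`); **`e_red_level`** (e_red♯): for data `Dj` at `(j, k)`
  and `Dj'` at `(j', k')` with `j ≤ j'`, `k ≤ k'`: `(R/π^{j'} ↠ R/π^j) (Dj'.e [x] [y]) = Dj.e [red x] [red y]` — in the
  refinement datum's currency `D.map j' j [y] = [redLE y]` (`map_mk_red`), so this is the level compatibility of the
  refined pairings.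
* §2 `toQuotRing_mem_maximalIdeal` (`toQuotRing` is local: `𝔪_{R_k} ↦ 𝔪_{R/π^j}`, `j ≥ 1`), **`h5c_level`** (h5c♯):
  `H5c Dj (S.levelToResidual hy i k) (S.residualTauQuot hy i)` at `j = i + 1` — from `SatisfiesH.h5c k` (`θ_k = θ_0`,
  `levelToResidual [s] = π̄_k s`).
* §3 (appended) **`h5b_level`** (h5b♯): H.5(b) for the structure propagated to `T^{(k)}/π^{i+1}` with the residual
  presentation `levelToResidual` and `residualTauQuot` — the same clause as `SatisfiesH.h5b k`
  (`PropagateTowerProofs.H5b_iff_of_comp` along `mkQ`).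

HONEST FRAMING: plumbing over `SatisfiesH.e_red`/`h5c`; the refined setting itself (R5/R6), Lemma 1.6.4 and
`thm161_dvrKolyvaginBound` are NOT proved; no summit statement is proved; the Birch–Swinnerton-Dyer conjecture is not
proved by any of this.
References: [Howard2004HeegnerKolyvagin] §1.3 H.4–H.5, Rem. 1.3.1, §1.6 (arXiv p. 7 L69 – p. 8 L1, p. 7 L125–127, p. 11
L33–38).
-/

set_option autoImplicit false

noncomputable section

open Function NumberField IsDedekindDomain Field
open scoped NumberField

namespace Literature.NumberTheory.GaloisCohomology.Howard2004

open Literature.NumberTheory.GaloisRepresentations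
open Literature.NumberTheory.GaloisRepresentations.DiscreteGaloisModule

namespace DVRSetting

variable {p : ℕ} [Fact p.Prime] {K : Type} [Field K] [NumberField K]
  {R : Type} [CommRing R] [IsDomain R] [IsDiscreteValuationRing R] [Algebra ℤ_[p] R]
  {N : ℕ → Type} [∀ k, AddCommGroup (N k)] [∀ k, TopologicalSpace (N k)]
  [∀ k, DiscreteTopology (N k)] [∀ k, Module R (N k)]
  {Rk : ℕ → Type} [∀ k, CommRing (Rk k)] [∀ k, IsLocalRing (Rk k)] [∀ k, TopologicalSpace (Rk k)]
  [∀ k, DiscreteTopology (Rk k)] [∀ k, Algebra ℤ_[p] (Rk k)] [∀ k, Algebra R (Rk k)]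
  [∀ k, Module (Rk k) (N k)] [∀ k, IsScalarTower R (Rk k) (N k)]
  {Nbar : Type} [AddCommGroup Nbar] [TopologicalSpace Nbar] [DiscreteTopology Nbar]
  [∀ k, Module (Rk k) Nbar]
  {Nq : ℕ → Finset (HeightOneSpectrum (𝓞 K)) → Type} [∀ k n, AddCommGroup (Nq k n)]
  [∀ k n, TopologicalSpace (Nq k n)] [∀ k n, DiscreteTopology (Nq k n)]
  [∀ k n, Module (Rk k) (Nq k n)] [∀ k n, Module R (Nq k n)]
  [∀ k n, IsScalarTower R (Rk k) (Nq k n)]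
  (S : DVRSetting p K R N Rk Nbar Nq)

/-! ## §1 `e_red♯`: the reduced pairings are compatible along the levels -/

/-- **`toQuotRing_j (e_{k+d}(x, y)) = toQuotRing_j (e_k(red x, red y))`**: the level pairings are compatible under the
reductions (`SatisfiesH.e_red`, iterated along `redLE`) and `toQuotRing` is compatible with `redR` (`toQuotRing_redR`).
[cite: Howard2004HeegnerKolyvagin, §1.3 H.4 and §1.6 (arXiv p. 7 L69–80, p. 11 L33–38: the level data are the reductions of data on `T`)] -/
theorem toQuotRing_e_redLE_add (hy : S.SatisfiesH) {j : ℕ} (k : ℕ) (hk : j ≤ S.e k) :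
    ∀ (d : ℕ) (hk' : j ≤ S.e (k + d)) (x y : N (k + d)),
      S.toQuotRing hy hk' ((S.D (k + d)).e x y) =
        S.toQuotRing hy hk ((S.D k).e (S.T.redLE (Nat.le_add_right k d) x) (S.T.redLE (Nat.le_add_right k d) y))
  | 0, hk', x, y => by
    change S.toQuotRing hy hk' ((S.D k).e x y) =
      S.toQuotRing hy hk ((S.D k).e (S.T.redLE (le_refl k) x) (S.T.redLE (le_refl k) y))
    rw [S.T.redLE_self, S.T.redLE_self]
  | d + 1, hk', x, y => by
    have hkd : j ≤ S.e (k + d) := hk.trans (hy.e_strictMono.monotone (Nat.le_add_right k d))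
    change S.toQuotRing hy hk' ((S.D (k + d + 1)).e x y) =
      S.toQuotRing hy hk ((S.D k).e (S.T.redLE (Nat.le_succ_of_le (Nat.le_add_right k d)) x)
        (S.T.redLE (Nat.le_succ_of_le (Nat.le_add_right k d)) y))
    rw [← S.toQuotRing_redR hy hkd hk' ((S.D (k + d + 1)).e x y), hy.e_red (k + d) x y,
      toQuotRing_e_redLE_add hy k hk d hkd, S.T.redLE_succ (Nat.le_add_right k d),
      S.T.redLE_succ (Nat.le_add_right k d)]

/-- The same for `k ≤ k'`. [cite: Howard2004HeegnerKolyvagin, §1.3 H.4 and §1.6 (arXiv p. 7 L69–80, p. 11 L33–38)] -/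
theorem toQuotRing_e_redLE (hy : S.SatisfiesH) {j k k' : ℕ} (hkk' : k ≤ k') (hk : j ≤ S.e k) (hk' : j ≤ S.e k')
    (x y : N k') :
    S.toQuotRing hy hk' ((S.D k').e x y) =
      S.toQuotRing hy hk ((S.D k).e (S.T.redLE hkk' x) (S.T.redLE hkk' y)) := by
  obtain ⟨d, rfl⟩ := Nat.exists_eq_add_of_le hkk'
  exact S.toQuotRing_e_redLE_add hy k hk d hk' x y

/-- **`e_red♯` (the refined pairings are compatible along the levels)**: for ANY reduced data `Dj` on `T^{(k)}/π^j`
and `Dj'` on `T^{(k')}/π^{j'}` (`j ≤ j'`, `k ≤ k'`, `j ≤ e_k`, `j' ≤ e_{k'}`) with the defining identities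
`Dj.e [s] [t] = toQuotRing (e_k(s,t))`, `Dj'.e [s] [t] = toQuotRing (e_{k'}(s,t))`:
`(R/π^{j'} ↠ R/π^j) (Dj'.e [x] [y]) = Dj.e [redLE x] [redLE y]` — on the refinement datum `D.map j' j [y] = [redLE y]`
(`PiRefinementDatum.map_mk_red`), so this is `SatisfiesH.e_red` for consecutive (indeed all) exponents of the refined
setting. [cite: Howard2004HeegnerKolyvagin, §1.3 H.4 with Rem. 1.3.1 and §1.6 (arXiv p. 7 L69–80, L125–127, p. 11 L33–38)] -/
theorem e_red_level (hy : S.SatisfiesH) {j j' k k' : ℕ} (hjj' : j ≤ j') (hkk' : k ≤ k') (hk : j ≤ S.e k)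
    (hk' : j' ≤ S.e k') :
    letI := S.quotRingTopology j
    haveI := S.quotRing_discreteTopology j
    letI := S.quotRingTopology j'
    haveI := S.quotRing_discreteTopology j'
    ∀ (Dj : DualityDatum p S.cd (modIdeal (S.T.ρ k) (S.T.hlin k) (Ideal.span {S.π ^ j})) (S.QuotRing j)),
      (∀ s t : N k, Dj.e (Submodule.Quotient.mk s) (Submodule.Quotient.mk t) = S.toQuotRing hy hk ((S.D k).e s t)) →
    ∀ (Dj' : DualityDatum p S.cd (modIdeal (S.T.ρ k') (S.T.hlin k') (Ideal.span {S.π ^ j'})) (S.QuotRing j')),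
      (∀ s t : N k', Dj'.e (Submodule.Quotient.mk s) (Submodule.Quotient.mk t) =
        S.toQuotRing hy hk' ((S.D k').e s t)) →
      ∀ x y : N k',
        Ideal.Quotient.factor (Ideal.span_singleton_le_span_singleton.mpr (pow_dvd_pow S.π hjj'))
            (Dj'.e (Submodule.Quotient.mk x) (Submodule.Quotient.mk y)) =
          Dj.e (Submodule.Quotient.mk (S.T.redLE hkk' x)) (Submodule.Quotient.mk (S.T.redLE hkk' y)) := by
  intro Dj hDj Dj' hDj' x y
  rw [hDj', hDj, S.factor_toQuotRing hy hjj' hk', S.toQuotRing_e_redLE hy hkk' hk (hjj'.trans hk')]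

/-! ## §2 `h5c♯`: H.5(c) for the reduced data -/

/-- `toQuotRing : R_k → R/π^j` is a LOCAL map for `j ≥ 1`: it carries `𝔪_{R_k} = (π̄)` into `𝔪_{R/π^j} = (π̄)`.
[cite: Howard2004HeegnerKolyvagin, §1.6 (arXiv p. 11 L13–14, L33–34)] -/
theorem toQuotRing_mem_maximalIdeal (hy : S.SatisfiesH) {j k : ℕ} (hj : 1 ≤ j) (h : j ≤ S.e k) {a : Rk k}
    (ha : a ∈ IsLocalRing.maximalIdeal (Rk k)) :
    haveI := S.isLocalRing_quotRing hy hj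
    S.toQuotRing hy h a ∈ IsLocalRing.maximalIdeal (S.QuotRing j) := by
  haveI := S.isLocalRing_quotRing hy hj
  rw [S.maximalIdeal_levelRing hy k, Ideal.mem_span_singleton'] at ha
  obtain ⟨b, rfl⟩ := ha
  obtain ⟨r, rfl⟩ := hy.algebraMap_surjective k b
  rw [S.maximalIdeal_quotRing hy hj, ← map_mul, S.toQuotRing_algebraMap hy h, map_mul]
  exact Ideal.mul_mem_left _ _ (Ideal.mem_span_singleton_self _)

/-- **`h5c♯` (Howard's H.5(c) on the levels of the refinement)**: for ANY reduced datum `Dj` on `T^{(k)}/π^{i+1}` with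
`Dj.e [s] [t] = toQuotRing (e_k(s,t))`, the residual pairing relation `(s^τ, t^τ) ≡ −(s, t) (mod 𝔪)` holds for the
residual presentation `levelToResidual : T^{(k)}/π^{i+1} ↠ T̄` and the re-based `θ` (`residualTauQuot`) of w2 g16's R2b —
from `SatisfiesH.h5c k` (one `θ` for all levels, `θ_eq_zero`; `toQuotRing` is local). [cite: Howard2004HeegnerKolyvagin, §1.3 H.5(c) with Rem. 1.3.1 (arXiv p. 7 L98 – p. 8 L1, p. 7 L125–127)] -/
theorem h5c_level (hy : S.SatisfiesH) (i k : ℕ) (h : i + 1 ≤ S.e k) :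
    letI := S.quotRingTopology (i + 1)
    haveI := S.quotRing_discreteTopology (i + 1)
    haveI := S.isLocalRing_quotRing hy (Nat.succ_pos i)
    letI := S.residualModule hy i
    ∀ (Dj : DualityDatum p S.cd (modIdeal (S.T.ρ k) (S.T.hlin k) (Ideal.span {S.π ^ (i + 1)})) (S.QuotRing (i + 1))),
      (∀ s t : N k, Dj.e (Submodule.Quotient.mk s) (Submodule.Quotient.mk t) = S.toQuotRing hy h ((S.D k).e s t)) →
      H5c Dj (S.levelToResidual hy i k) (S.residualTauQuot hy i) := by
  letI := S.quotRingTopology (i + 1)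
  haveI := S.quotRing_discreteTopology (i + 1)
  haveI := S.isLocalRing_quotRing hy (Nat.succ_pos i)
  letI := S.residualModule hy i
  intro Dj hDj s t s' t' hs ht
  obtain ⟨s, rfl⟩ := Submodule.Quotient.mk_surjective _ s
  obtain ⟨t, rfl⟩ := Submodule.Quotient.mk_surjective _ t
  obtain ⟨s', rfl⟩ := Submodule.Quotient.mk_surjective _ s'
  obtain ⟨t', rfl⟩ := Submodule.Quotient.mk_surjective _ t'
  rw [S.levelToResidual_mk, S.levelToResidual_mk] at hs ht
  change S.πbar k s' = (S.A 0).θ (S.πbar k s) at hs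
  change S.πbar k t' = (S.A 0).θ (S.πbar k t) at ht
  rw [← S.θ_eq_zero hy k] at hs ht
  have h5 := hy.h5c k s t s' t' hs ht
  -- `e_k(s', t') + e_k(s, t) ∈ 𝔪_{R_k}`
  rw [← map_neg, Ideal.Quotient.eq, sub_neg_eq_add] at h5
  rw [hDj, hDj, ← map_neg, Ideal.Quotient.eq, sub_neg_eq_add, ← map_add]
  exact S.toQuotRing_mem_maximalIdeal hy (Nat.succ_pos i) h h5

/-! ## §3 `h5b♯`: H.5(b) for the propagated structures on the levels (appended) -/

/-- **`h5b♯` (Howard's H.5(b) on the levels of the refinement)**: the structure propagated from `T^{(k)}` to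
`T^{(k)}/π^{i+1}T^{(k)}` is `G_ℚ`-stable at the residual level — the SAME clause as `SatisfiesH.h5b k`, because the
residual presentation `levelToResidual` of the level factors the one of `T^{(k)}` (`π̄_k = levelToResidual ∘ mkQ`,
`levelToResidual_mk`), the `θ`'s agree (`θ_eq_zero`) and the propagated structure on `T̄` is the same
(`PropagateTowerProofs.H5b_iff_of_comp` read downward along `mkQ`).
[cite: Howard2004HeegnerKolyvagin, §1.3 H.5(b) with Rem. 1.3.1 (arXiv p. 7 L96–97, L125–127)] -/
theorem h5b_level (hy : S.SatisfiesH) (i k : ℕ) :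
    haveI := S.isLocalRing_quotRing hy (Nat.succ_pos i)
    letI := S.residualModule hy i
    H5b (modIdeal (S.T.ρ k) (S.T.hlin k) (Ideal.span {S.π ^ (i + 1)})) (S.isQuotientBy_levelToResidual hy i k)
      (S.residualTauQuot hy i)
      ((isQuotientBy_modIdeal (S.T.ρ k) (S.T.hlin k) (Ideal.span {S.π ^ (i + 1)})).propagateStructure
        (S.t k).cond) := by
  haveI := S.isLocalRing_quotRing hy (Nat.succ_pos i)
  letI := S.residualModule hy i
  exact (H5b_iff_of_comp (hy.h1 k).1 (S.isQuotientBy_levelToResidual hy i k) (S.A k) (S.residualTauQuot hy i)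
    (fun x => S.θ_eq_zero hy k x)
    (Ideal.span {S.π ^ (i + 1)} • (⊤ : Submodule R (N k))).mkQ.toAddMonoidHom (fun _ _ => rfl) (fun _ => rfl)
    (S.t k).cond
    ((isQuotientBy_modIdeal (S.T.ρ k) (S.T.hlin k) (Ideal.span {S.π ^ (i + 1)})).propagateStructure (S.t k).cond)
    (fun _ => rfl)).1 (hy.h5b k)

end DVRSetting

end Literature.NumberTheory.GaloisCohomology.Howard2004

end
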